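import Literature.Algebra.Polynomial.UmbralOperators
import Mathlib.Tactic
import HarnessLib

/-!
# Umbral composition: Rota–Kahaner–Odlyzko's Theorem 7 and its corollaries (§7)

G.-C. Rota, D. Kahaner, A. Odlyzko, *Finite operator calculus* (1973), §7:

> **Theorem 7 (Umbral Composition).** Let `s_n (x)` and `t_n (x)` be Sheffer sets relative to the
> delta operators `Q` and `P`, and to the invertible shift-invariant operators `S` and `T`,
> respectively. Let `q_n (x)` and `p_n (x)` be the basic sets for `Q` and `P`, and let the indicators
> of `S`, `Q`, and `P` be `S = s (D)`, `Q = q (D)`, `P = p (D)`, where `s (t)`, `q (t)` and `p (t)`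
> are formal power series. Define `r_n (x)` to be the umbral composition of `s_n (x)` and `t_n (x)`,
> in symbols `r_n (x) = s_n (t (x))`. Then `r_n (x)` is a Sheffer set relative to the shift-invariant
> operator `t (D) s (p (D))` and the delta operator `q (p (D))` having as basic set the sequence
> `q_n (p (x))`. [Proof: "let `V : xⁿ → p_n (x)` be an umbral operator. Then `u_n (x) = V q_n (x)`,
> and … the delta operator `V Q V⁻¹` of `u_n (x)` is of the form `q (P) = q (p (D))` … `V S V⁻¹ =
> s (p (D))`".]
> **Corollary 1.** If `p_n (x)` and `q_n (x)` are basic sets with delta operators `P = p (D)` and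
> `Q = q (D)`, then `p_n (q (x))` is a basic set with delta operator `p (q (D))`.
> **Corollary 2.** If `s_n (x)` and `t_n (x)` are Appell sets, then `s_n (t (x))` is an Appell set with
> operator `S T`; in particular, `s_n (t (x)) = t_n (s (x))`.
> **Corollary 3.** If `r_n (x)` is a Sheffer set, then there is a unique Sheffer set `s_n (x)`, called
> the inverse set, such that `r_n (s (x)) = xⁿ`. If `p_n (x)` and `q_n (x)` are the corresponding
> basic sequences, then the basic sequence of `r_n (s (x))` is `p_n (q (x))`.
> **Corollary 4.** … the constants `s_{nk}` such that `v_n (x) = Σ_k s_{nk} t_k (x)` are uniquely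
> determined as follows. The polynomial sequence `s_n (x) = Σ_k s_{nk} x^k` is the Sheffer set with
> delta operator `u (p⁻¹ (D))` …
> **Corollary 6.** Suppose `p_n (x)` and `q_n (x)` are the basic sequences for the delta operators `P`
> and `Q`, respectively. If `q_n (x)` is inverse to `p_n (x)`, then
> `p_n (x) = Σ_{k≥0} x^k/k! · [Q^k xⁿ]_{x=0}`.
> **Corollary 7 (Summation Formula).** Let `f (x)` be any polynomial. Then, in the notation of the
> preceding corollary, `f (p (x)) = Σ_{k≥0} x^k/k! · [Q^k f (x)]_{x=0}`. The prototype of this formula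
> is the classical formula of Dobinski for the exponential polynomials.
> **Proposition 3.** Let `W : p_n (x) → xⁿ` be an umbral operator, and let `Q` be the delta operator
> of `p_n (x)`. Then `W x p (x) = x W Q' p (x)` for all polynomials `p (x)`.
> **Proposition 4.** If `s_n (x)` is a Sheffer set, so is `aⁿ s_n (bx)` for any `a` and `b`; if it is
> a basic set, so are `aⁿ s_n (bx)` and `x s_n (x − na)/(x − na)`. [Before: "if `Q` is the delta
> operator of `p_k (x)`, then `a⁻¹ Q` is the delta operator of `a^k p_k (x)`. Similarly … if
> `Q = f (D)`, then the delta operator for `p_n (ax)` is `f (a⁻¹ D)`."]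

Dictionary: as in `UmbralOperators` (`umbral b : xⁿ ↦ b_n`, `umbralComp a b n = a_n (b (x))`),
`PowerSeriesInDeltaOperator` (`φ(δ) = diffOp (φ.subst q)`, the compositional inverse
`q̄ = hδ.indicator derivative`). Sheffer sets are in the tree's normalization `s_n = σ(D) q_n`
(Robert §6.1; RKO's `S` is `σ(D)⁻¹`), so the printed "relative to the invertible operator
`t (D) s (p (D))`" reads `r_n = (τ · (σ ∘ π))(D) (q ∘ p)_n`. The third clause of Proposition 4 is the
Translation Principle, already in the tree (`IsDeltaOperator.basicSequence_taylor_comp`).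

Main statements (theorems only): `umbral_comp_umbral` (`umbral b ∘ umbral a = umbral (a ∘ b)`),
`umbral_diffOp_apply` (`V ψ(D) = ψ(p(D)) V`), `isDeltaOperator_diffOp_subst` (`q (p (D))` is a delta
operator), `IsBasicSequence.umbralComp_diffOp_subst` (Corollary 1), `umbralComp_eq_diffOp_apply` (Theorem 7, the
formula), `isShefferSequence_umbralComp_of_diffOp_eq` / `IsShefferSequence.umbralComp_diffOp_subst` (Theorem 7 /
"the umbral composition of two Sheffer sets is a Sheffer set"), `umbralComp_appell_eq_diffOp`,
`IsAppellSequence.umbralComp_appell`, `IsAppellSequence.umbralComp_comm` (Corollary 2),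
`IsBasicSequence.umbralComp_basicSequence_indicator_derivative` (the basic sets of `q(D)` and `q̄(D)`
are inverse to each other), `umbralComp_inverseSet_eq_X_pow`, `umbralComp_inverse_unique`,
`umbralComp_inverse_comm` (Corollary 3), `umbralComp_eq_iff_eq_umbralComp_inverse` (Corollary 4),
`umbral_eq_sum_of_umbralComp_eq_X_pow` / `eq_sum_of_umbralComp_eq_X_pow` (Corollaries 7, 6),
`umbralEquiv_X_mul` (Proposition 3), `IsBasicSequence.comp_C_mul_X`, `IsBasicSequence.pow_smul`,
`IsShefferSequence.pow_smul_comp_C_mul_X` (Proposition 4).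

## References
* [RotaKahanerOdlyzko1973] G.-C. Rota, D. Kahaner, A. Odlyzko, *On the foundations of
  combinatorial theory VIII. Finite operator calculus*, J. Math. Anal. Appl. 42 (1973) 684–760,
  §7 Theorem 7, Corollaries 1–7, Propositions 3–4, pp. 708–711.
* [Robert2000PadicAnalysis] A. M. Robert, *A Course in p-adic Analysis*, GTM 198, Springer (2000),
  Ch. IV §6.1 (Sheffer sequences, normalization `s_n = S p_n`), pp. 207–209.
-/

noncomputable section

open Polynomial Finset

namespace Literature.Algebra.Polynomial

variable {K : Type*} [Field K]

/-! ## Umbral composition is composition of umbral operators -/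

/-- **`umbral b ∘ umbral a = umbral (a ∘ b)`**: composing the umbral representations composes the
sequences umbrally ("umbral composition of polynomials is simply the application of umbral
operators"). [cite: RotaKahanerOdlyzko1973, §7, p. 706] -/
theorem umbral_comp_umbral (a b : ℕ → K[X]) : umbral b ∘ₗ umbral a = umbral (umbralComp a b) :=
  eq_umbral_of_map_X_pow fun n => by rw [LinearMap.comp_apply, umbral_X_pow, umbralComp_apply]

/-- Pointwise: `umbral b (umbral a f) = umbral (a ∘ b) f`. [cite: RotaKahanerOdlyzko1973, §7, p. 706] -/
theorem umbral_umbral_apply (a b : ℕ → K[X]) (f : K[X]) :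
    umbral b (umbral a f) = umbral (umbralComp a b) f := by
  rw [← LinearMap.comp_apply, umbral_comp_umbral]

/-- **Associativity of umbral composition**: `(a ∘ b) ∘ c = a ∘ (b ∘ c)`.
[cite: RotaKahanerOdlyzko1973, §7, p. 706] -/
theorem umbralComp_assoc (a b c : ℕ → K[X]) :
    umbralComp (umbralComp a b) c = umbralComp a (umbralComp b c) := by
  funext n
  rw [umbralComp_apply, umbralComp_apply, umbralComp_apply, umbral_umbral_apply]

/-- If `T p_n = t_n` for a linear `T`, then `umbral t = T ∘ umbral p`.
[cite: RotaKahanerOdlyzko1973, §7 (proof of Theorem 7: "`t_n (x) = T⁻¹ p_n (x)`"), p. 709] -/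
theorem umbral_eq_comp_umbral {p t : ℕ → K[X]} {T : K[X] →ₗ[K] K[X]} (hT : ∀ n, T (p n) = t n) :
    umbral t = T ∘ₗ umbral p :=
  (eq_umbral_of_map_X_pow fun n => by rw [LinearMap.comp_apply, umbral_X_pow, hT]).symm

/-! ## Proposition 4: scaling `aⁿ s_n (bx)` -/

section Scaling

/-- `Dᵏ (f (bx)) = bᵏ (Dᵏ f)(bx)`. [cite: RotaKahanerOdlyzko1973, §7 (before Proposition 4: "the delta
operator for `p_n (ax)` is `f (a⁻¹ D)`"), p. 711] -/
theorem iterate_derivative_comp_C_mul_X (f : K[X]) (b : K) (k : ℕ) :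
    derivative^[k] (f.comp (C b * X)) = C (b ^ k) * (derivative^[k] f).comp (C b * X) := by
  induction k with
  | zero => rw [Function.iterate_zero_apply, Function.iterate_zero_apply, pow_zero, C_1, one_mul]
  | succ k ih =>
    rw [Function.iterate_succ_apply', ih, derivative_C_mul, derivative_comp, derivative_C_mul_X,
      ← mul_assoc, ← C_mul, ← pow_succ, Function.iterate_succ_apply']

/-- **`ψ(D) (f (bx)) = (ψ (bD) f)(bx)`**, i.e. conjugating `ψ(D)` by the dilation `x ↦ bx` rescales
the indicator ("if `Q = f (D)`, then the delta operator for `p_n (ax)` is `f (a⁻¹ D)`").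
[cite: RotaKahanerOdlyzko1973, §7 (before Proposition 4), p. 711] -/
theorem diffOp_apply_comp_C_mul_X (ψ : PowerSeries K) (f : K[X]) (b : K) :
    diffOp ψ (f.comp (C b * X)) = (diffOp (PowerSeries.rescale b ψ) f).comp (C b * X) := by
  have h1 : (f.comp (C b * X)).natDegree < max (f.comp (C b * X)).natDegree f.natDegree + 1 := by omega
  have h2 : f.natDegree < max (f.comp (C b * X)).natDegree f.natDegree + 1 := by omega
  rw [diffOp_apply ψ _ h1, diffOp_apply _ f h2]
  conv_rhs => rw [← coe_compRingHom_apply, map_sum]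
  refine sum_congr rfl fun k _ => ?_
  rw [coe_compRingHom_apply, smul_comp, iterate_derivative_comp_C_mul_X, C_mul', smul_smul,
    PowerSeries.coeff_rescale, mul_comm]

/-- `(f (bx))(0) = f (0)`. [cite: RotaKahanerOdlyzko1973, §7 Proposition 4, p. 711] -/
theorem eval_zero_comp_C_mul_X (f : K[X]) (b : K) : (f.comp (C b * X)).eval 0 = f.eval 0 := by
  rw [eval_comp, eval_mul, eval_C, eval_X, mul_zero]

/-- `f (D)` a delta operator, `b ≠ 0` ⇒ `f (b⁻¹ D)` is a delta operator.
[cite: RotaKahanerOdlyzko1973, §7 (before Proposition 4), p. 711] -/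
theorem IsDeltaOperator.rescale {κ : PowerSeries K} (hQ : IsDeltaOperator (diffOp κ)) {b : K} (hb : b ≠ 0) :
    IsDeltaOperator (diffOp (PowerSeries.rescale b⁻¹ κ)) :=
  (isDeltaOperator_diffOp_iff _).2
    ⟨by rw [← PowerSeries.coeff_zero_eq_constantCoeff_apply, PowerSeries.coeff_rescale, pow_zero, one_mul,
        PowerSeries.coeff_zero_eq_constantCoeff_apply, hQ.constantCoeff_eq_zero],
      by rw [PowerSeries.coeff_rescale, pow_one]; exact mul_ne_zero (inv_ne_zero hb) hQ.coeff_one_ne_zero⟩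

/-- **Proposition 4, basic sets, dilation**: if `(p_n)` is basic for `f (D)` then `(p_n (bx))` is
basic for `f (b⁻¹ D)` (`b ≠ 0`). [cite: RotaKahanerOdlyzko1973, §7 Proposition 4 and the preceding
paragraph, p. 711] -/
theorem IsBasicSequence.comp_C_mul_X {κ : PowerSeries K} {p : ℕ → K[X]} (hp : IsBasicSequence (diffOp κ) p)
    {b : K} (hb : b ≠ 0) :
    IsBasicSequence (diffOp (PowerSeries.rescale b⁻¹ κ)) fun n => (p n).comp (C b * X) where
  natDegree_eq n := by rw [natDegree_comp, hp.natDegree_eq, natDegree_C_mul_X b hb, mul_one]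
  map_succ n := by
    rw [diffOp_apply_comp_C_mul_X, PowerSeries.rescale_rescale, inv_mul_cancel₀ hb, PowerSeries.rescale_one,
      RingHom.id_apply, hp.map_succ, smul_comp]
  apply_zero := by rw [hp.apply_zero, one_comp]
  eval_zero_succ n := by rw [eval_zero_comp_C_mul_X, hp.eval_zero_succ]

/-- **Proposition 4, basic sets, `aᵏ p_k`**: "if `Q` is the delta operator of `p_k (x)`, then `a⁻¹ Q`
is the delta operator of `a^k p_k (x)`" (`a ≠ 0`). [cite: RotaKahanerOdlyzko1973, §7 (before
Proposition 4), p. 711] -/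
theorem IsBasicSequence.pow_smul {Q : K[X] →ₗ[K] K[X]} {p : ℕ → K[X]} (hp : IsBasicSequence Q p)
    {a : K} (ha : a ≠ 0) : IsBasicSequence (a⁻¹ • Q) fun n => a ^ n • p n where
  natDegree_eq n := by rw [natDegree_smul _ (pow_ne_zero n ha), hp.natDegree_eq]
  map_succ n := by
    rw [LinearMap.smul_apply, map_smul, hp.map_succ, smul_smul, smul_smul, smul_smul]
    congr 1
    rw [pow_succ]
    field_simp
  apply_zero := by rw [pow_zero, one_smul, hp.apply_zero]
  eval_zero_succ n := by rw [eval_smul, hp.eval_zero_succ, smul_zero]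

/-- `a⁻¹ Q` is a delta operator when `Q` is (`a ≠ 0`).
[cite: RotaKahanerOdlyzko1973, §7 (before Proposition 4), p. 711] -/
theorem IsDeltaOperator.inv_smul {Q : K[X] →ₗ[K] K[X]} (hQ : IsDeltaOperator Q) {a : K} (ha : a ≠ 0) :
    IsDeltaOperator (a⁻¹ • Q) :=
  hQ.smul (inv_ne_zero ha)

/-- **Proposition 4, Sheffer sets**: "if `s_n (x)` is a Sheffer set, so is `aⁿ s_n (bx)`" (`a, b ≠ 0`;
relative to `a⁻¹ f (b⁻¹ D)` when `s_n` is relative to `f (D)`).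
[cite: RotaKahanerOdlyzko1973, §7 Proposition 4, p. 711] -/
theorem IsShefferSequence.pow_smul_comp_C_mul_X {κ : PowerSeries K} {s : ℕ → K[X]}
    (hs : IsShefferSequence (diffOp κ) s) {a b : K} (ha : a ≠ 0) (hb : b ≠ 0) :
    IsShefferSequence (a⁻¹ • diffOp (PowerSeries.rescale b⁻¹ κ)) fun n => a ^ n • (s n).comp (C b * X) := by
  refine ⟨fun n => ?_, fun n => ?_⟩
  · have hcomp : ((s n).comp (C b * X)).comp (C b⁻¹ * X) = s n := by
      rw [comp_assoc, mul_comp, C_comp, X_comp, ← mul_assoc, ← C_mul, mul_inv_cancel₀ hb, C_1, one_mul,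
        comp_X]
    have hne : (s n).comp (C b * X) ≠ 0 := fun h => hs.ne_zero n (by rw [← hcomp, h, zero_comp])
    rw [smul_eq_C_mul, degree_C_mul (pow_ne_zero n ha), degree_eq_natDegree hne, natDegree_comp,
      hs.natDegree_eq, natDegree_C_mul_X b hb, mul_one]
  · rw [LinearMap.smul_apply, map_smul, diffOp_apply_comp_C_mul_X, PowerSeries.rescale_rescale,
      inv_mul_cancel₀ hb, PowerSeries.rescale_one, RingHom.id_apply, hs.map_succ, smul_comp, smul_smul,
      smul_smul, smul_smul]
    congr 1
    rw [pow_succ]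
    field_simp

end Scaling

/-! ## Theorem 7 -/

section UmbralComposition

variable [CharZero K] {π κ : PowerSeries K} {p q : ℕ → K[X]}

/-- **"`V S V⁻¹ = s (p (D))`"**: the umbral operator `V : xⁿ ↦ p_n` intertwines `ψ(D)` and
`ψ (p (D))`: `V (ψ(D) f) = (ψ ∘ π)(D) (V f)` for `(p_n)` basic for `π(D)`.
[cite: RotaKahanerOdlyzko1973, §7 (proof of Theorem 7) and Proposition 1 (e), pp. 707, 709] -/
theorem umbral_diffOp_apply (hP : IsDeltaOperator (diffOp π)) (hp : IsBasicSequence (diffOp π) p)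
    (ψ : PowerSeries K) (f : K[X]) : umbral p (diffOp ψ f) = diffOp (ψ.subst π) (umbral p f) := by
  have hconj := isBasicSequence_derivative_X_pow.conj_eq_diffOp isDeltaOperator_derivative hP hp
    (isShiftInvariant_diffOp ψ) (rfl : diffOp π = diffOp π)
  rw [indicator_derivative_diffOp] at hconj
  have h := LinearMap.congr_fun hconj (isBasicSequence_derivative_X_pow.umbralEquiv hp f)
  rw [LinearEquiv.conj_apply_apply, LinearEquiv.symm_apply_apply] at h
  rw [umbral_eq_umbralEquiv hp, LinearEquiv.coe_coe]
  exact h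

omit [CharZero K] in
/-- **`q (p (D))` is a delta operator** (`p (0) = q (0) = 0`, `p' (0) q' (0) ≠ 0`).
[cite: RotaKahanerOdlyzko1973, §7 Theorem 7 ("the delta operator `q (p (D))`"), p. 709] -/
theorem isDeltaOperator_diffOp_subst (hP : IsDeltaOperator (diffOp π)) (hQ : IsDeltaOperator (diffOp κ)) :
    IsDeltaOperator (diffOp (κ.subst π)) :=
  (isDeltaOperator_diffOp_iff _).2
    ⟨by rw [powerSeries_constantCoeff_subst hP.constantCoeff_eq_zero, hQ.constantCoeff_eq_zero],
      by rw [powerSeries_coeff_one_subst hP.constantCoeff_eq_zero]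
         exact mul_ne_zero hQ.coeff_one_ne_zero hP.coeff_one_ne_zero⟩

/-- `V Q V⁻¹ = q (p (D))` for `V : xⁿ ↦ p_n`, `Q = q(D)`. [cite: RotaKahanerOdlyzko1973, §7 (proof of
Theorem 7: "the delta operator `V Q V⁻¹` of `u_n (x)` is of the form `q (P) = q (p (D))`"), p. 709] -/
theorem conj_diffOp_eq (hP : IsDeltaOperator (diffOp π)) (hp : IsBasicSequence (diffOp π) p)
    (ψ : PowerSeries K) :
    ((isBasicSequence_derivative_X_pow.umbralEquiv hp).conj (diffOp ψ) : K[X] →ₗ[K] K[X]) =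
      diffOp (ψ.subst π) := by
  have hconj := isBasicSequence_derivative_X_pow.conj_eq_diffOp isDeltaOperator_derivative hP hp
    (isShiftInvariant_diffOp ψ) (rfl : diffOp π = diffOp π)
  rwa [indicator_derivative_diffOp] at hconj

/-- **Corollary 1 / Theorem 7 (basic part)**: `q_n (p (x))` is the basic set of the delta operator
`q (p (D))` ("the umbral composition of two sequences of basic polynomials is again a basic sequence").
[cite: RotaKahanerOdlyzko1973, §7 Theorem 7 and Corollary 1, p. 709] -/
theorem IsBasicSequence.umbralComp_diffOp_subst (hP : IsDeltaOperator (diffOp π)) (hp : IsBasicSequence (diffOp π) p)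
    (hq : IsBasicSequence (diffOp κ) q) : IsBasicSequence (diffOp (κ.subst π)) (umbralComp q p) := by
  have h := hp.isBasicSequence_umbralComp hP hq
  rwa [conj_diffOp_eq hP hp κ] at h

/-- The basic set of `q (p (D))` IS `q_n (p (x))`. [cite: RotaKahanerOdlyzko1973, §7 Corollary 1, p. 709] -/
theorem IsDeltaOperator.basicSequence_diffOp_subst (hP : IsDeltaOperator (diffOp π))
    (hp : IsBasicSequence (diffOp π) p) (hQ : IsDeltaOperator (diffOp κ)) (hq : IsBasicSequence (diffOp κ) q)
    (n : ℕ) : (isDeltaOperator_diffOp_subst hP hQ).basicSequence n = umbralComp q p n := by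
  rw [← (hp.umbralComp_diffOp_subst hP hq).eq_basicSequence (isDeltaOperator_diffOp_subst hP hQ)]

/-- **Theorem 7 (Umbral Composition), the formula**: for `s_n = σ(D) q_n` and `t_n = τ(D) p_n`,
`s_n (t (x)) = (τ · (σ ∘ π))(D) applied to q_n (p (x))` ("relative to the shift-invariant operator
`t (D) s (p (D))`", in the tree's normalization). [cite: RotaKahanerOdlyzko1973, §7 Theorem 7 and
proof ("`s_n (p (x)) = V S⁻¹ V⁻¹ u_n (x)`"), p. 709] -/
theorem umbralComp_eq_diffOp_apply (hP : IsDeltaOperator (diffOp π)) (hp : IsBasicSequence (diffOp π) p)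
    (σ τ : PowerSeries K) {s t : ℕ → K[X]} (hs : ∀ n, diffOp σ (q n) = s n)
    (ht : ∀ n, diffOp τ (p n) = t n) (n : ℕ) :
    umbralComp s t n = diffOp (τ * σ.subst π) (umbralComp q p n) := by
  rw [umbralComp_apply, umbral_eq_comp_umbral ht, LinearMap.comp_apply, ← hs,
    umbral_diffOp_apply hP hp σ (q n), ← umbralComp_apply, diffOp_mul, LinearMap.comp_apply]

/-- **Theorem 7 (Umbral Composition)**: with `σ (0) τ (0) ≠ 0` (invertible operators), `s_n (t (x))` is
a Sheffer set relative to the delta operator `q (p (D))`.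
[cite: RotaKahanerOdlyzko1973, §7 Theorem 7, pp. 708–709] -/
theorem isShefferSequence_umbralComp_of_diffOp_eq (hP : IsDeltaOperator (diffOp π))
    (hp : IsBasicSequence (diffOp π) p) (hQ : IsDeltaOperator (diffOp κ)) (hq : IsBasicSequence (diffOp κ) q)
    {σ τ : PowerSeries K} (hσ : PowerSeries.constantCoeff σ ≠ 0) (hτ : PowerSeries.constantCoeff τ ≠ 0)
    {s t : ℕ → K[X]} (hs : ∀ n, diffOp σ (q n) = s n) (ht : ∀ n, diffOp τ (p n) = t n) :
    IsShefferSequence (diffOp (κ.subst π)) (umbralComp s t) := by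
  have heq : umbralComp s t = fun n => diffOp (τ * σ.subst π) (umbralComp q p n) :=
    funext (umbralComp_eq_diffOp_apply hP hp σ τ hs ht)
  rw [heq]
  refine (hp.umbralComp_diffOp_subst hP hq).isShefferSequence_map (isDeltaOperator_diffOp_subst hP hQ)
    (isShiftInvariant_diffOp _) ?_
  rw [diffOp_apply_one, Ne, C_eq_zero, map_mul, powerSeries_constantCoeff_subst hP.constantCoeff_eq_zero]
  exact mul_ne_zero hτ hσ

/-- A Sheffer set `(s_n)` for `δ` with basic set `(q_n)` is `s_n = σ(D) q_n` for a series with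
`σ (0) ≠ 0` (Robert §6.1 Proposition, packaged with the indicator of §4).
[cite: Robert2000PadicAnalysis, Ch. IV §6.1 Proposition, p. 208]
[cite: RotaKahanerOdlyzko1973, §5 Proposition 1, p. 698] -/
theorem IsShefferSequence.exists_diffOp_eq {δ : K[X] →ₗ[K] K[X]} {q s : ℕ → K[X]} (hδ : IsDeltaOperator δ)
    (hq : IsBasicSequence δ q) (hs : IsShefferSequence δ s) :
    ∃ σ : PowerSeries K, PowerSeries.constantCoeff σ ≠ 0 ∧ ∀ n, diffOp σ (q n) = s n := by
  obtain ⟨S, hS, hSb, hSq⟩ := hs.exists_isShiftInvariant hδ hq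
  obtain ⟨σ, rfl⟩ := isShiftInvariant_iff_exists_eq_diffOp.1 hS
  refine ⟨σ, fun h => ?_, hSq⟩
  exact (hS.bijective_iff_map_one.1 hSb) (by rw [diffOp_apply_one, h, C_0])

/-- **"The umbral composition of two Sheffer sets is a Sheffer set"** (Corollary to Proposition 2,
made precise by Theorem 7): `s` Sheffer for `q(D)`, `t` Sheffer for `p(D)` ⇒ `s ∘ t` Sheffer for
`q (p (D))`. [cite: RotaKahanerOdlyzko1973, §7 Corollary to Proposition 2 and Theorem 7, pp. 708–709] -/
theorem IsShefferSequence.umbralComp_diffOp_subst (hP : IsDeltaOperator (diffOp π)) (hQ : IsDeltaOperator (diffOp κ))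
    {s t : ℕ → K[X]} (hs : IsShefferSequence (diffOp κ) s) (ht : IsShefferSequence (diffOp π) t) :
    IsShefferSequence (diffOp (κ.subst π)) (umbralComp s t) := by
  obtain ⟨σ, hσ, hσq⟩ := hs.exists_diffOp_eq hQ hQ.isBasicSequence_basicSequence
  obtain ⟨τ, hτ, hτp⟩ := ht.exists_diffOp_eq hP hP.isBasicSequence_basicSequence
  exact isShefferSequence_umbralComp_of_diffOp_eq hP hP.isBasicSequence_basicSequence hQ
    hQ.isBasicSequence_basicSequence hσ hτ hσq hτp

/-! ## Corollary 2: Appell sets -/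

omit [CharZero K] in
/-- `(xⁿ)` is the basic set of `t(D) = D`. [cite: RotaKahanerOdlyzko1973, §2 ("`xⁿ`, basic for the
derivative operator"), p. 689] -/
theorem isBasicSequence_diffOp_X_X_pow : IsBasicSequence (diffOp (PowerSeries.X : PowerSeries K)) fun n => X ^ n := by
  rw [diffOp_X]
  exact isBasicSequence_derivative_X_pow

omit [CharZero K] in
/-- `t(D) = D` is a delta operator. [cite: RotaKahanerOdlyzko1973, §3 Corollary 2, p. 693] -/
theorem isDeltaOperator_diffOp_X : IsDeltaOperator (diffOp (PowerSeries.X : PowerSeries K)) :=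
  (isDeltaOperator_diffOp_iff _).2 ⟨PowerSeries.constantCoeff_X, by
    rw [PowerSeries.coeff_one_X]; exact one_ne_zero⟩

/-- **Corollary 2, the formula**: for Appell sets `s_n = σ(D) xⁿ`, `t_n = τ(D) xⁿ`:
`s_n (t (x)) = (τσ)(D) xⁿ` ("an Appell set with operator `ST`").
[cite: RotaKahanerOdlyzko1973, §7 Corollary 2, p. 709] -/
theorem umbralComp_appell_eq_diffOp (σ τ : PowerSeries K) {s t : ℕ → K[X]}
    (hs : ∀ n, diffOp σ (X ^ n) = s n) (ht : ∀ n, diffOp τ (X ^ n) = t n) (n : ℕ) :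
    umbralComp s t n = diffOp (τ * σ) (X ^ n) := by
  have h := umbralComp_eq_diffOp_apply (q := fun n => X ^ n) isDeltaOperator_diffOp_X
    isBasicSequence_diffOp_X_X_pow σ τ hs ht n
  rwa [PowerSeries.X_subst, umbralComp_X_pow_left] at h

/-- **Corollary 2, commutativity**: "in particular, `s_n (t (x)) = t_n (s (x))`" for Appell sets.
[cite: RotaKahanerOdlyzko1973, §7 Corollary 2, p. 709] -/
theorem umbralComp_appell_comm (σ τ : PowerSeries K) {s t : ℕ → K[X]}
    (hs : ∀ n, diffOp σ (X ^ n) = s n) (ht : ∀ n, diffOp τ (X ^ n) = t n) :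
    umbralComp s t = umbralComp t s := by
  funext n
  rw [umbralComp_appell_eq_diffOp σ τ hs ht, umbralComp_appell_eq_diffOp τ σ ht hs, mul_comm]

/-- **Corollary 2**: the umbral composition of two Appell sets is an Appell set.
[cite: RotaKahanerOdlyzko1973, §7 Corollary 2, p. 709] -/
theorem IsAppellSequence.umbralComp_appell {s t : ℕ → K[X]} (hs : IsAppellSequence s) (ht : IsAppellSequence t) :
    IsAppellSequence (umbralComp s t) := by
  have hs' : IsShefferSequence (diffOp (PowerSeries.X : PowerSeries K)) s := by rw [diffOp_X]; exact hs
  have ht' : IsShefferSequence (diffOp (PowerSeries.X : PowerSeries K)) t := by rw [diffOp_X]; exact ht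
  have h := hs'.umbralComp_diffOp_subst isDeltaOperator_diffOp_X isDeltaOperator_diffOp_X ht'
  rwa [PowerSeries.X_subst, diffOp_X] at h

/-- **Corollary 2**: `s_n (t (x)) = t_n (s (x))` for Appell sets.
[cite: RotaKahanerOdlyzko1973, §7 Corollary 2, p. 709] -/
theorem IsAppellSequence.umbralComp_comm {s t : ℕ → K[X]} (hs : IsAppellSequence s) (ht : IsAppellSequence t) :
    umbralComp s t = umbralComp t s := by
  have hs' : IsShefferSequence (diffOp (PowerSeries.X : PowerSeries K)) s := by rw [diffOp_X]; exact hs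
  have ht' : IsShefferSequence (diffOp (PowerSeries.X : PowerSeries K)) t := by rw [diffOp_X]; exact ht
  obtain ⟨σ, -, hσ⟩ := hs'.exists_diffOp_eq isDeltaOperator_diffOp_X isBasicSequence_diffOp_X_X_pow
  obtain ⟨τ, -, hτ⟩ := ht'.exists_diffOp_eq isDeltaOperator_diffOp_X isBasicSequence_diffOp_X_X_pow
  exact umbralComp_appell_comm σ τ hσ hτ

/-! ## Corollary 3: inverse sets -/

/-- `q̄(D)` is a delta operator (`q̄ = q⁻¹` the compositional inverse, `q̄ (0) = 0`, `q̄' (0) q' (0) = 1`).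
[cite: RotaKahanerOdlyzko1973, §7 Corollary 3 and §3 Corollary 2, pp. 693, 709] -/
theorem IsDeltaOperator.diffOp_indicator_derivative (hP : IsDeltaOperator (diffOp π)) :
    IsDeltaOperator (diffOp (hP.indicator derivative)) :=
  (isDeltaOperator_diffOp_iff _).2 ⟨hP.constantCoeff_indicator_derivative, fun h => by
    have h1 := hP.coeff_one_indicator_derivative_mul rfl
    rw [h, zero_mul] at h1
    exact zero_ne_one h1⟩

/-- **The basic sets of `q (D)` and of `q̄ (D)` are inverse to each other**:
`p_n (p̄ (x)) = xⁿ` for `(p_n)` basic for `π(D)` and `(p̄_n)` basic for `π̄(D)`, `π̄ = π⁻¹` — by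
Corollary 1, `p ∘ p̄` is basic for `π (π̄ (D)) = D`. (For instance `(x)_n` and the exponential
polynomials, `e^t − 1` and `log (1 + t)`.) [cite: RotaKahanerOdlyzko1973, §7 Corollary 3 ("the
basic sequence of `r_n (s (x))` is `p_n (q (x))`") and §14 ("the `φ_n` are inverse to `(x)_n`"),
pp. 709, 747] -/
theorem IsBasicSequence.umbralComp_eq_X_pow_of_subst_eq_X {π ρ : PowerSeries K} {p r : ℕ → K[X]}
    (hp : IsBasicSequence (diffOp π) p) (hR : IsDeltaOperator (diffOp ρ))
    (hr : IsBasicSequence (diffOp ρ) r) (hπρ : (π.subst ρ : PowerSeries K) = PowerSeries.X) (n : ℕ) :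
    umbralComp p r n = X ^ n := by
  have h := hr.umbralComp_diffOp_subst hR hp
  rw [hπρ, diffOp_X] at h
  rw [h.unique isDeltaOperator_derivative isBasicSequence_derivative_X_pow]

/-- The basic set of `π(D)` composed with the basic set of `π̄(D)` is `xⁿ`.
[cite: RotaKahanerOdlyzko1973, §7 Corollary 3, p. 709] -/
theorem IsBasicSequence.umbralComp_basicSequence_indicator_derivative (hP : IsDeltaOperator (diffOp π))
    (hp : IsBasicSequence (diffOp π) p) (n : ℕ) :
    umbralComp p hP.diffOp_indicator_derivative.basicSequence n = X ^ n :=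
  hp.umbralComp_eq_X_pow_of_subst_eq_X hP.diffOp_indicator_derivative
    hP.diffOp_indicator_derivative.isBasicSequence_basicSequence (hP.subst_indicator_derivative rfl) n

/-- … and in the other order: `p̄_n (p (x)) = xⁿ`. [cite: RotaKahanerOdlyzko1973, §7 Corollary 3, p. 709] -/
theorem IsBasicSequence.umbralComp_basicSequence_indicator_derivative' (hP : IsDeltaOperator (diffOp π))
    (hp : IsBasicSequence (diffOp π) p) (n : ℕ) :
    umbralComp hP.diffOp_indicator_derivative.basicSequence p n = X ^ n :=
  hP.diffOp_indicator_derivative.isBasicSequence_basicSequence.umbralComp_eq_X_pow_of_subst_eq_X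
    hP hp (hP.indicator_derivative_subst rfl) n

/-- **Corollary 3, existence, with the explicit inverse set**: for the Sheffer set `r_n = ρ(D) p_n`
(`(p_n)` basic for `π(D)`, `ρ (0) ≠ 0`), the Sheffer set `s_n = ((ρ ∘ π̄)⁻¹)(D) p̄_n` (`p̄` the basic
set of `π̄(D)`) satisfies `r_n (s (x)) = xⁿ`. [cite: RotaKahanerOdlyzko1973, §7 Corollary 3, p. 709] -/
theorem umbralComp_inverseSet_eq_X_pow (hP : IsDeltaOperator (diffOp π)) (hp : IsBasicSequence (diffOp π) p)
    {ρ : PowerSeries K} (hρ : PowerSeries.constantCoeff ρ ≠ 0) {r : ℕ → K[X]}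
    (hr : ∀ n, diffOp ρ (p n) = r n) (n : ℕ) :
    umbralComp r (fun k => diffOp (ρ.subst (hP.indicator derivative) : PowerSeries K)⁻¹
      (hP.diffOp_indicator_derivative.basicSequence k)) n = X ^ n := by
  have hρ' : PowerSeries.constantCoeff (ρ.subst (hP.indicator derivative) : PowerSeries K) ≠ 0 := by
    rwa [powerSeries_constantCoeff_subst hP.constantCoeff_indicator_derivative]
  rw [umbralComp_eq_diffOp_apply hP.diffOp_indicator_derivative
      hP.diffOp_indicator_derivative.isBasicSequence_basicSequence ρ _ hr (fun k => rfl) n,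
    PowerSeries.inv_mul_cancel _ hρ', diffOp_one, LinearMap.id_apply,
    hp.umbralComp_basicSequence_indicator_derivative hP n]

/-- The inverse set is a Sheffer set (relative to `π̄(D)`).
[cite: RotaKahanerOdlyzko1973, §7 Corollary 3, p. 709] -/
theorem isShefferSequence_inverseSet (hP : IsDeltaOperator (diffOp π)) {ρ : PowerSeries K}
    (hρ : PowerSeries.constantCoeff ρ ≠ 0) :
    IsShefferSequence (diffOp (hP.indicator derivative)) fun k =>
      diffOp (ρ.subst (hP.indicator derivative) : PowerSeries K)⁻¹
        (hP.diffOp_indicator_derivative.basicSequence k) := by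
  have hρ' : PowerSeries.constantCoeff (ρ.subst (hP.indicator derivative) : PowerSeries K) ≠ 0 := by
    rwa [powerSeries_constantCoeff_subst hP.constantCoeff_indicator_derivative]
  refine hP.diffOp_indicator_derivative.isBasicSequence_basicSequence.isShefferSequence_map
    hP.diffOp_indicator_derivative (isShiftInvariant_diffOp _) ?_
  rw [diffOp_apply_one, Ne, C_eq_zero, PowerSeries.constantCoeff_inv]
  exact inv_ne_zero hρ'

/-- The umbral representation of a Sheffer set is onto (indeed invertible: `umbral r = ρ(D) ∘ V`).
[cite: RotaKahanerOdlyzko1973, §7 (proof of Theorem 7), p. 709] -/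
theorem umbral_bijective_of_diffOp_eq (hp : IsBasicSequence (diffOp π) p)
    {ρ : PowerSeries K} (hρ : PowerSeries.constantCoeff ρ ≠ 0) {r : ℕ → K[X]}
    (hr : ∀ n, diffOp ρ (p n) = r n) : Function.Bijective (umbral r) := by
  rw [umbral_eq_comp_umbral hr, umbral_eq_umbralEquiv hp, LinearMap.coe_comp, LinearEquiv.coe_coe]
  exact (diffOp_bijective hρ).comp (LinearEquiv.bijective _)

omit [CharZero K] in
/-- `r ∘ s = (xⁿ)` says `umbral s ∘ umbral r = id`. [cite: RotaKahanerOdlyzko1973, §7 Corollary 3, p. 709] -/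
theorem umbral_comp_umbral_eq_id_iff (r s : ℕ → K[X]) :
    umbral s ∘ₗ umbral r = LinearMap.id ↔ umbralComp r s = fun n => X ^ n := by
  rw [umbral_comp_umbral]
  refine ⟨fun h => funext fun n => ?_, fun h => by rw [h, umbral_X_pow_eq_id]⟩
  rw [← umbral_X_pow (umbralComp r s) n, h, LinearMap.id_apply]

omit [CharZero K] in
/-- **Corollary 3, uniqueness**: a sequence `r` whose umbral representation is onto (e.g. a Sheffer
set, `umbral_bijective_of_diffOp_eq`) has at most one inverse set.
[cite: RotaKahanerOdlyzko1973, §7 Corollary 3 ("there is a unique Sheffer set … called the inverse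
set"), p. 709] -/
theorem umbralComp_inverse_unique {r s s' : ℕ → K[X]} (hr : Function.Surjective (umbral r))
    (hs : umbralComp r s = fun n => X ^ n) (hs' : umbralComp r s' = fun n => X ^ n) : s = s' := by
  have h1 := (umbral_comp_umbral_eq_id_iff r s).2 hs
  have h2 := (umbral_comp_umbral_eq_id_iff r s').2 hs'
  have hss : umbral s = umbral s' := by
    refine LinearMap.ext fun g => ?_
    obtain ⟨f, rfl⟩ := hr g
    have e1 := LinearMap.congr_fun h1 f
    have e2 := LinearMap.congr_fun h2 f
    rw [LinearMap.comp_apply, LinearMap.id_apply] at e1 e2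
    rw [e1, e2]
  funext n
  rw [← umbral_X_pow s n, hss, umbral_X_pow]

omit [CharZero K] in
/-- **Inverse sets are two-sided**: if `umbral r` is bijective and `r_n (s (x)) = xⁿ` then also
`s_n (r (x)) = xⁿ`. [cite: RotaKahanerOdlyzko1973, §7 Corollary 3, p. 709] -/
theorem umbralComp_inverse_comm {r s : ℕ → K[X]} (hr : Function.Bijective (umbral r))
    (hs : umbralComp r s = fun n => X ^ n) : umbralComp s r = fun n => X ^ n := by
  have h1 := (umbral_comp_umbral_eq_id_iff r s).2 hs
  refine (umbral_comp_umbral_eq_id_iff s r).1 (LinearMap.ext fun g => ?_)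
  obtain ⟨f, rfl⟩ := hr.2 g
  have e1 := LinearMap.congr_fun h1 f
  rw [LinearMap.comp_apply, LinearMap.id_apply] at e1
  rw [LinearMap.comp_apply, LinearMap.id_apply, e1]

/-- `s_n (r (x)) = xⁿ` for the explicit inverse set `s` of the Sheffer set `r`.
[cite: RotaKahanerOdlyzko1973, §7 Corollary 3, p. 709] -/
theorem umbralComp_inverseSet_eq_X_pow' (hP : IsDeltaOperator (diffOp π)) (hp : IsBasicSequence (diffOp π) p)
    {ρ : PowerSeries K} (hρ : PowerSeries.constantCoeff ρ ≠ 0) {r : ℕ → K[X]}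
    (hr : ∀ n, diffOp ρ (p n) = r n) :
    umbralComp (fun k => diffOp (ρ.subst (hP.indicator derivative) : PowerSeries K)⁻¹
      (hP.diffOp_indicator_derivative.basicSequence k)) r = fun n => X ^ n :=
  umbralComp_inverse_comm (umbral_bijective_of_diffOp_eq hp hρ hr)
    (funext (umbralComp_inverseSet_eq_X_pow hP hp hρ hr))

/-! ## Corollary 4: connection constants -/

omit [CharZero K] in
/-- **Corollary 4 (connection constants)**: let `t` be a sequence with bijective umbral
representation (a Sheffer set) and `t̂` its inverse set (`t ∘ t̂ = xⁿ`). For any sequence `v`, the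
unique `s` with `v_n = Σ_k s_{nk} t_k`, i.e. `v = s ∘ t`, is `s = v ∘ t̂` (and by Theorem 7 it is a
Sheffer set for `u (p̄ (D))` when `v` is one for `u (D)` and `t̂` for `p̄ (D)`, `IsShefferSequence.umbralComp_diffOp_subst`).
[cite: RotaKahanerOdlyzko1973, §7 Corollary 4, p. 710] -/
theorem umbralComp_eq_iff_eq_umbralComp_inverse {t that : ℕ → K[X]} (ht : Function.Bijective (umbral t))
    (hthat : umbralComp t that = fun n => X ^ n) (s v : ℕ → K[X]) :
    umbralComp s t = v ↔ s = umbralComp v that := by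
  have h1 := (umbral_comp_umbral_eq_id_iff t that).2 hthat
  have h2 := (umbral_comp_umbral_eq_id_iff that t).2 (umbralComp_inverse_comm ht hthat)
  constructor
  · rintro rfl
    funext n
    rw [umbralComp_apply, umbralComp_apply, ← LinearMap.comp_apply, h1, LinearMap.id_apply]
  · rintro rfl
    funext n
    rw [umbralComp_apply, umbralComp_apply, ← LinearMap.comp_apply, h2, LinearMap.id_apply]

/-! ## Corollaries 6–7: the summation formula -/

/-- **Corollary 7 (Summation Formula)**: if `q_n (p (x)) = xⁿ` (`q` basic for `Q`, inverse to `p`),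
then for any polynomial `f`, `f (p (x)) = Σ_k [Q^k f]_{x=0}/k! · x^k` ("the prototype of this formula is
the classical formula of Dobinski for the exponential polynomials").
[cite: RotaKahanerOdlyzko1973, §7 Corollary 7, p. 711] -/
theorem umbral_eq_sum_of_umbralComp_eq_X_pow {Q : K[X] →ₗ[K] K[X]} {q p : ℕ → K[X]}
    (hQ : IsDeltaOperator Q) (hq : IsBasicSequence Q q) (hqp : umbralComp q p = fun n => X ^ n) (f : K[X])
    {N : ℕ} (hN : f.natDegree < N) :
    umbral p f = ∑ k ∈ range N, (((Q ^ k) f).eval 0 / (k.factorial : K)) • X ^ k := by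
  calc umbral p f = umbral p (∑ k ∈ range N, (((Q ^ k) f).eval 0 / (k.factorial : K)) • q k) :=
        congrArg (umbral p) (hq.eq_sum hQ f hN)
    _ = ∑ k ∈ range N, (((Q ^ k) f).eval 0 / (k.factorial : K)) • X ^ k := by
        rw [map_sum]
        refine sum_congr rfl fun k _ => ?_
        rw [map_smul, ← umbralComp_apply, hqp]

/-- **Corollary 6**: if `q_n (x)` is inverse to `p_n (x)`, then `p_n (x) = Σ_k x^k/k! · [Q^k xⁿ]_{x=0}`.
[cite: RotaKahanerOdlyzko1973, §7 Corollary 6, p. 710] -/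
theorem eq_sum_of_umbralComp_eq_X_pow {Q : K[X] →ₗ[K] K[X]} {q p : ℕ → K[X]} (hQ : IsDeltaOperator Q)
    (hq : IsBasicSequence Q q) (hqp : umbralComp q p = fun n => X ^ n) (n : ℕ) :
    p n = ∑ k ∈ range (n + 1), (((Q ^ k) (X ^ n)).eval 0 / (k.factorial : K)) • X ^ k := by
  rw [← umbral_X_pow p n]
  exact umbral_eq_sum_of_umbralComp_eq_X_pow hQ hq hqp (X ^ n) (by rw [natDegree_X_pow]; exact lt_add_one n)

/-! ## Proposition 3: `W x = x W Q'` -/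

/-- **Proposition 3**: for the umbral operator `W : p_n ↦ xⁿ` (`(p_n)` basic for `Q = q(D)`) and the
Pincherle derivative `Q' = q'(D)`: `W (x f) = x · W (Q' f)` for all polynomials `f` (from Rodrigues'
formula `x (Q')⁻¹ p_n = p_{n+1}`). [cite: RotaKahanerOdlyzko1973, §7 Proposition 3, p. 711] -/
theorem umbralEquiv_X_mul {κ : PowerSeries K} {p : ℕ → K[X]} (hQ : IsDeltaOperator (diffOp κ))
    (hp : IsBasicSequence (diffOp κ) p) (f : K[X]) :
    hp.umbralEquiv isBasicSequence_derivative_X_pow (X * f) =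
      X * hp.umbralEquiv isBasicSequence_derivative_X_pow (diffOp (PowerSeries.derivative K κ) f) := by
  set W := hp.umbralEquiv (isBasicSequence_derivative_X_pow (K := K)) with hW
  obtain ⟨φ, hφ0, hδφ⟩ := hQ.exists_eq_derivative_comp
  have hκ : κ = PowerSeries.X * φ := diffOp_injective (by rw [hδφ, derivative_comp_diffOp_eq])
  have hp' : IsBasicSequence (derivative ∘ₗ diffOp φ : K[X] →ₗ[K] K[X]) p := hδφ ▸ hp
  have hpb : p = (isDeltaOperator_derivative_comp_diffOp hφ0).basicSequence :=
    hp'.eq_basicSequence (isDeltaOperator_derivative_comp_diffOp hφ0)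
  have hκ' : PowerSeries.constantCoeff (PowerSeries.derivative K κ) ≠ 0 := by
    rw [hκ, constantCoeff_derivative_X_mul]
    exact hφ0
  -- Rodrigues' formula `p_{n+1} = x (Q')⁻¹ p_n`
  have hrod : ∀ n, p (n + 1) = X * diffOp (PowerSeries.derivative K κ)⁻¹ (p n) := fun n => by
    rw [hpb, basicSequence_derivative_comp_diffOp_succ hφ0 n, ← hκ]
  -- `W x (Q')⁻¹ = x W` on the basis `(p_n)`
  have hlin : (W : K[X] →ₗ[K] K[X]) ∘ₗ LinearMap.mulLeft K (X : K[X]) ∘ₗ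
      diffOp (PowerSeries.derivative K κ)⁻¹ = LinearMap.mulLeft K (X : K[X]) ∘ₗ (W : K[X] →ₗ[K] K[X]) := by
    refine hp.linearMap_ext fun n => ?_
    simp only [LinearMap.comp_apply, LinearMap.mulLeft_apply, LinearEquiv.coe_coe]
    rw [← hrod, hW, hp.umbralEquiv_apply, hp.umbralEquiv_apply, pow_succ']
  have hinv : ∀ g : K[X], diffOp (PowerSeries.derivative K κ)⁻¹ (diffOp (PowerSeries.derivative K κ) g) = g :=
    fun g => by
      have h := LinearMap.congr_fun (diffOp_inv_comp_diffOp hκ') g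
      rwa [LinearMap.comp_apply, LinearMap.id_apply] at h
  have h := LinearMap.congr_fun hlin (diffOp (PowerSeries.derivative K κ) f)
  simp only [LinearMap.comp_apply, LinearMap.mulLeft_apply, LinearEquiv.coe_coe] at h
  rw [hinv] at h
  exact h

end UmbralComposition

end Literature.Algebra.Polynomial
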